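import Mathlib
import HarnessLib
import Summits.AtomisticToContinuum.FouriersLaw.Theses.JunctionLocality
import Summits.AtomisticToContinuum.FouriersLaw.Theses.StaticAbelianSqueeze
import Summits.AtomisticToContinuum.FouriersLaw.Theorems.JunctionLocalityConductanceLowerBoundAbelFloorFrequently

/-!
# Line `abel-floor-exchange` — crux `ConductanceLowerBound` (item stmt-AtomisticToContinuum-11749) — skeleton v3.1 (lead c7, 2026-08-17)

Crux (shared by 10 routes): along unique weak steady-state families of `pinnedChain ω₂ lam β γ` (all `> 0`),
for every `T > 0` and response coefficients `D_N`: `∃ c > 0 ∃ N₁ ∀ N ≥ N₁, c ≤ D_N`.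

## The language (Green–Kubo/Abel, crux-strategist s2) and the v3 cut

By the LANDED open-chain Kubo identity (K) `StaticAbelianSqueeze.kuboAbelIdentity_holds` (stmt-13419),
`(N−1)·T²·D_N = ∫₀^∞ c_N(t) dt`, `c_N(t) = ∫ J_N · (P_t J_N) dμ_{N,T}` the equilibrium autocorrelation of the TOTAL current of the
open `N`-chain (both baths at `T`).  Split at an `N`-INDEPENDENT Abel frequency `ν` (`integral_abelSplit`, landed):
`∫₀^∞ c_N = F_N(ν) + I_N(ν)`, `F_N(ν) = ∫ e^{−νt} c_N`, `I_N(ν) = ∫ (1 − e^{−νt}) c_N`.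

v1/v2 (s2, leads c5/c6) cut the crux as (A⁻) ∧ (R⁻) with (A⁻) an `N`-uniform Abel floor at EVERY small `ν`.  The composition uses the floor at
ONE frequency below the threshold of (R⁻), so v3 WEAKENS the bulk stub to "frequently in `ν`":

* `stub_openChainAbelFloorFrequently` (A⁻⁻) — `∃ a > 0 ∀ ν₁ > 0 ∃ ν ∈ (0, ν₁)`, eventually in `N`, `F_N(ν) ≥ a·N`.  By the landed file
  `Theorems/JunctionLocalityConductanceLowerBoundAbelFloorFrequently.lean` (p161612) it is EQUIVALENT to W⁻ = "the shift-invariant Gibbs bulk is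
  NOT AN ABEL INSULATOR" (`limsup_{ν↓0} Â(ν) > 0` at a regular witness: `abelFloorFrequently_openChain_iff_bulkWitnessFrequently`), is implied by
  v2's (A⁻) (`abelFloorFrequently_openChain_of_abelFloor_openChain`; hence supplied on CageBudgetFekete p156938, CoercivePulse p157637,
  HoelderEscapeProfile p160912, StaticAbelianSqueeze-with-static-floor p160999), and is NECESSARY modulo the sibling (R)
  (`abelFloorFrequently_openChain_of_conductanceLowerBound_of_uniformAbelianRegularity`; under (R): crux ↔ W⁻ ↔ W, p161612/p161062).
  Open-problem grade (positivity of bulk energy transport of a deterministic anharmonic chain in its weakest, Abel/limsup, rate-free form).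
* `stub_signedSlowRegularity` (R⁻) — unchanged: the lower half of stmt-13416 (`slowRegularity_signed_of_uniformAbelianRegularity`, p156938);
  reading: "the open chains conduct at least as well as the bulk" (no extensive contact resistance).

Composition = the landed `conductanceLowerBound_of_abelFloorFrequently_and_signedSlowRegularity` (p161612): `ν₂ = ν₀(a/2)` from (R⁻), one
`ν ∈ (0,ν₂)` from (A⁻⁻), `(N−1)T²D_N = F_N(ν) + I_N(ν) ≥ aN − (a/2)N`, so `D_N ≥ a/(2T²)` for `N ≥ max(N₁,N₂,2)`.  The skeleton theorem
`ConductanceLowerBound_of : JunctionLocality.ConductanceLowerBound` concludes the crux BY NAME from the two registered stubs.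

Disproof used: `conductanceLowerBound_false_without_baths_or_uniqueness` (γ = 0 / no uniqueness) is honoured through (K), whose proof consumes
`0 < γ` and weak-NESS uniqueness; at the harmonic corner (A⁻⁻), (R⁻) and the crux all hold (`Negative/HarmonicCornerLowerBound`), so no stub is an
instance of a landed Negative lemma.  Disproof.lean v2.4 has no `-- Targets`.
-/

noncomputable section

open MeasureTheory Filter Set Topology
open Literature.MathematicalPhysics.KineticTheory.HeatConduction
open Summit.AtomisticToContinuum.FouriersLaw.Theorems

namespace Summit.AtomisticToContinuum.FouriersLaw.Cruxes.ConductanceLowerBound.AbelFloorExchange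

/-! ## §1 The registered stubs -/

/-- **(A⁻⁻) OPEN-CHAIN ABEL FLOOR, FREQUENTLY IN THE FREQUENCY (stub 1 of v3, the bet; open-problem, XL).** For `pinnedChain ω₂ lam β γ`
(all `> 0`) and `T > 0` there is `a > 0` such that below EVERY threshold `ν₁ > 0` some Abel frequency `ν ∈ (0, ν₁)` has, eventually in `N`,
`a·N ≤ ∫₀^∞ e^{−νt} c_N(t) dt`, `c_N(t) = ∫ J_N (P_t J_N) dμ_{N,T}`, `J_N = Σ_i j_i` — the bulk is not an Abel insulator
(`limsup_{ν↓0} Â(ν) > 0` at the shift-invariant Gibbs state, by the landed matching S3). -/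
theorem stub_openChainAbelFloorFrequently :
    ∀ ω₂ lam β γ : ℝ, 0 < ω₂ → 0 < lam → 0 < β → 0 < γ → ∀ T : ℝ, 0 < T →
      ∃ a : ℝ, 0 < a ∧ ∀ ν₁ : ℝ, 0 < ν₁ → ∃ ν : ℝ, 0 < ν ∧ ν < ν₁ ∧ ∃ N₀ : ℕ, ∀ N : ℕ, N₀ ≤ N →
        a * N ≤ ∫ t in Set.Ioi (0:ℝ), Real.exp (-(ν * t)) *
          ∫ z, (∑ i : Fin N, (pinnedChain ω₂ lam β γ).bondCurrent N i z) *
            (∫ y, (∑ i : Fin N, (pinnedChain ω₂ lam β γ).bondCurrent N i y)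
              ∂((pinnedChain ω₂ lam β γ).transitionKernel N T T t.toNNReal z))
            ∂((pinnedChain ω₂ lam β γ).gibbsMeasure N T) := by
  sorry

/-- **(R⁻) SIGNED SLOW REGULARITY (stub 2; open-problem, L–XL; the lower half of item stmt-13416 `UniformAbelianRegularity`).**
For `pinnedChain ω₂ lam β γ` (all `> 0`), `T > 0` and `ε > 0` there is `ν₀ > 0` such that for every `ν ∈ (0, ν₀)`, eventually in `N`,
the SLOW part of the open chain's Green–Kubo integral is not extensively negative:
`−ε·N ≤ ∫₀^∞ (1 − e^{−νt}) c_N(t) dt`. -/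
theorem stub_signedSlowRegularity :
    ∀ ω₂ lam β γ : ℝ, 0 < ω₂ → 0 < lam → 0 < β → 0 < γ → ∀ T : ℝ, 0 < T →
      ∀ ε : ℝ, 0 < ε → ∃ ν₀ : ℝ, 0 < ν₀ ∧ ∀ ν : ℝ, 0 < ν → ν < ν₀ → ∃ N₀ : ℕ, ∀ N : ℕ, N₀ ≤ N →
        -(ε * N) ≤ ∫ t in Set.Ioi (0:ℝ), (1 - Real.exp (-(ν * t))) *
          ∫ z, (∑ i : Fin N, (pinnedChain ω₂ lam β γ).bondCurrent N i z) *
            (∫ y, (∑ i : Fin N, (pinnedChain ω₂ lam β γ).bondCurrent N i y)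
              ∂((pinnedChain ω₂ lam β γ).transitionKernel N T T t.toNNReal z))
            ∂((pinnedChain ω₂ lam β γ).gibbsMeasure N T) := by
  sorry

/-! ## §2 The composition: the registered stubs prove the crux BY NAME (everything else is landed) -/

/-- **THE SKELETON THEOREM (v3.1)** — `JunctionLocality.ConductanceLowerBound` (the item's primary decl; the other nine route copies are
definitionally equal) from the two registered stubs by the landed v3 composition (p161612). -/
theorem ConductanceLowerBound_of :
    Summit.AtomisticToContinuum.FouriersLaw.Theses.JunctionLocality.ConductanceLowerBound :=
  conductanceLowerBound_of_abelFloorFrequently_and_signedSlowRegularity stub_openChainAbelFloorFrequently stub_signedSlowRegularity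

/-! ## §3 Route reading through the v3 cut (all inputs landed) -/

/-- **W ∧ (R) ⇒ crux through v3**: a shift-invariant bulk Abel-floor witness (hypothesis shape of the landed bridge
`abelFloor_openChain_of_bulkWitness`; supplied on CageBudgetFekete p156938, CoercivePulse p157637, HoelderEscapeProfile p160912) and the sibling
`UniformAbelianRegularity` (stmt-13416) give the crux, via (A⁻) ⇒ (A⁻⁻). [cite: KunduDharNarayan2009, p. 3] -/
theorem conductanceLowerBound_of_bulkWitness_of_uniformAbelianRegularity
    (hW : ∀ ω₂ lam β γ : ℝ, 0 < ω₂ → 0 < lam → 0 < β → 0 < γ → ∀ T : ℝ, 0 < T →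
      ∃ (μT : Measure ChainConfig) (D : InfiniteChainDynamics (pinnedChain ω₂ lam β γ)) (a ν₀ : ℝ),
        (pinnedChain ω₂ lam β γ).IsChainGibbsMeasure T μT ∧ IsShiftInvariant μT ∧
        D.PreservesMeasure μT ∧ (∀ t : ℝ, D.HasAbsConvergentCorrelation μT t) ∧ 0 < a ∧ 0 < ν₀ ∧
        ∀ ν : ℝ, 0 < ν → ν < ν₀ →
          a ≤ ∫ t in Set.Ioi (0:ℝ), Real.exp (-(ν * t)) * D.currentCorrelation μT t)
    (hR : Summit.AtomisticToContinuum.FouriersLaw.Theses.StaticAbelianSqueeze.UniformAbelianRegularity) :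
    Summit.AtomisticToContinuum.FouriersLaw.Theses.JunctionLocality.ConductanceLowerBound :=
  conductanceLowerBound_of_abelFloorFrequently_and_signedSlowRegularity
    (abelFloorFrequently_openChain_of_abelFloor_openChain (abelFloor_openChain_of_bulkWitness hW))
    (slowRegularity_signed_of_uniformAbelianRegularity hR)

end Summit.AtomisticToContinuum.FouriersLaw.Cruxes.ConductanceLowerBound.AbelFloorExchange

end
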